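import Summits.KontsevichZagierPeriods.KontsevichZagierPeriods.Theorems.LinRedNormalFormArrangementNormalFormStubRebaseSimpleZeroNestedDiffExpand

/-!
# Stub `stub_rebaseSimpleZeroTwo`, part `rebaseSimpleZero_nestedDifferent` (crux
`ArrangementNormalForm`, line `janus-bands`) — brick `NestedDiffRankOne`

**Rank-one rational affine changes of variables** (rule 2 of the Kontsevich–Zagier calculus):
the map `Ψ w = w + (φ(w) + c₀) · x` with a rational linear functional `φ(w) = ∑ₗ coefₗ wₗ`, a
rational vector `x` and a rational constant `c₀`, under the non-degeneracy `1 + φ(x) ≠ 0`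
(`RebaseDiff.rkMap`; inverse `RebaseDiff.rkInv`, Jacobian `1 + φ(x)` by the rank-one determinant
lemma `RebaseZero.det_id_add_smulRight`). Every frame change of variables of the rebase of a
nested pair with letters of different slopes is of this form (one coordinate is replaced by a
rational affine combination of all of them): the base change `y ↦ (tᵢ − cᵢ(y))` of the frame
piece of the edge expansion, and the two charts of the letter–letter expansion. The move
`RebaseDiff.rankOne_cov` (registered as `rebaseSimpleZero_rankOneCov`) is the pull-back form of
rule (2) (`RebaseZero.cov_pull`) for `Ψ`: the new domain is any semialgebraic set exchanged with
the old one by `Ψ`/`Ψ⁻¹`, the new integrand is `(f ∘ Ψ) · |1 + φ(x)|`.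

References: M. Kontsevich, D. Zagier, *Periods* (2001), §1.2, rule (2).
-/

noncomputable section

open Set MeasureTheory MvPolynomial
open Literature.NumberTheory.Transcendental Literature.ModelTheory.ExponentialFields

namespace Summit.KontsevichZagierPeriods.ArrangementNormalForm.JanusBands

namespace RebaseDiff

open SeparatePos RebasePos RebaseZero RebaseNest

variable {n : ℕ}

/-! ### The rank-one affine map -/

/-- The rational linear functional `φ(w) = ∑ₗ coefₗ wₗ`. -/
def rkFun (coef : Fin n → ℚ) : (Fin n → ℝ) →L[ℝ] ℝ :=
  ∑ l, ((coef l : ℚ) : ℝ) • ContinuousLinearMap.proj (R := ℝ) (φ := fun _ : Fin n => ℝ) l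

/-- `rkFun` in coordinates. -/
theorem rkFun_apply (coef : Fin n → ℚ) (w : Fin n → ℝ) : rkFun coef w = ∑ l, (coef l : ℝ) * w l := by
  simp [rkFun]

/-- The rational vector `x` read in `ℝⁿ`. -/
def rkVec (x : Fin n → ℚ) : Fin n → ℝ := fun l => (x l : ℝ)

/-- The rank-one affine map `Ψ w = w + (φ(w) + c₀) · x`. -/
def rkMap (coef x : Fin n → ℚ) (c₀ : ℚ) (w : Fin n → ℝ) : Fin n → ℝ :=
  w + (rkFun coef w + c₀) • rkVec x

/-- `rkMap` in coordinates. -/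
theorem rkMap_apply (coef x : Fin n → ℚ) (c₀ : ℚ) (w : Fin n → ℝ) (l : Fin n) :
    rkMap coef x c₀ w l = w l + ((∑ l', (coef l' : ℝ) * w l') + c₀) * x l := by
  simp [rkMap, rkVec, rkFun_apply]

/-- The linear part `1 + x ⊗ φ` of `rkMap`. -/
def rkLin (coef x : Fin n → ℚ) : (Fin n → ℝ) →L[ℝ] (Fin n → ℝ) :=
  ContinuousLinearMap.id ℝ _ + (rkFun coef).smulRight (rkVec x)

/-- The Jacobian number `1 + φ(x)`. -/
def rkJac (coef x : Fin n → ℚ) : ℚ := 1 + ∑ l, coef l * x l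

/-- `φ(x)` is the rational number `∑ coefₗ xₗ`. -/
theorem rkFun_rkVec (coef x : Fin n → ℚ) : rkFun coef (rkVec x) = ((∑ l, coef l * x l : ℚ) : ℝ) := by
  rw [rkFun_apply]
  push_cast
  rfl

/-- The determinant of the linear part is `1 + φ(x)`. -/
theorem rkLin_det (coef x : Fin n → ℚ) : (rkLin coef x).det = (rkJac coef x : ℝ) := by
  rw [rkLin, det_id_add_smulRight, rkFun_rkVec, rkJac]
  push_cast
  rfl

/-- `rkMap` has derivative `rkLin` everywhere. -/
theorem hasFDerivAt_rkMap (coef x : Fin n → ℚ) (c₀ : ℚ) (w : Fin n → ℝ) :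
    HasFDerivAt (rkMap coef x c₀) (rkLin coef x) w := by
  have h : HasFDerivAt (fun w => rkFun coef w + (c₀ : ℝ)) (rkFun coef) w :=
    (rkFun coef).hasFDerivAt.add_const _
  exact (hasFDerivAt_id w).add (h.smul_const (rkVec x))

/-- The inverse map `Ψ⁻¹ z = z − ((φ(z) + c₀)/(1 + φ(x))) · x`. -/
def rkInv (coef x : Fin n → ℚ) (c₀ : ℚ) (z : Fin n → ℝ) : Fin n → ℝ :=
  z - ((rkFun coef z + c₀) / (rkJac coef x : ℝ)) • rkVec x

/-- `rkInv` in coordinates. -/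
theorem rkInv_apply (coef x : Fin n → ℚ) (c₀ : ℚ) (z : Fin n → ℝ) (l : Fin n) :
    rkInv coef x c₀ z l = z l - (((∑ l', (coef l' : ℝ) * z l') + c₀) / (rkJac coef x : ℝ)) * x l := by
  simp [rkInv, rkVec, rkFun_apply]

/-- `φ` of a rank-one update. -/
theorem rkFun_add_smul (coef x : Fin n → ℚ) (w : Fin n → ℝ) (t : ℝ) :
    rkFun coef (w + t • rkVec x) = rkFun coef w + t * ((∑ l, coef l * x l : ℚ) : ℝ) := by
  rw [map_add, map_smul, rkFun_rkVec, smul_eq_mul]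

/-- `φ` of a rank-one downdate. -/
theorem rkFun_sub_smul (coef x : Fin n → ℚ) (w : Fin n → ℝ) (t : ℝ) :
    rkFun coef (w - t • rkVec x) = rkFun coef w - t * ((∑ l, coef l * x l : ℚ) : ℝ) := by
  rw [map_sub, map_smul, rkFun_rkVec, smul_eq_mul]

/-- The Jacobian number, cast. -/
theorem cast_rkJac (coef x : Fin n → ℚ) :
    ((rkJac coef x : ℚ) : ℝ) = 1 + ((∑ l, coef l * x l : ℚ) : ℝ) := by
  rw [rkJac]; push_cast; rfl

/-- `Ψ ∘ Ψ⁻¹ = id`. -/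
theorem rkMap_rkInv (coef x : Fin n → ℚ) (c₀ : ℚ) (hJ : rkJac coef x ≠ 0) (z : Fin n → ℝ) :
    rkMap coef x c₀ (rkInv coef x c₀ z) = z := by
  have hJ' : (1 : ℝ) + ((∑ l, coef l * x l : ℚ) : ℝ) ≠ 0 := by
    rw [← cast_rkJac]; exact_mod_cast hJ
  have key : rkFun coef (rkInv coef x c₀ z) + c₀ = (rkFun coef z + c₀) / (rkJac coef x : ℝ) := by
    rw [rkInv, rkFun_sub_smul, cast_rkJac]
    field_simp
    ring
  rw [rkMap, key, rkInv, sub_add_cancel]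

/-- `Ψ⁻¹ ∘ Ψ = id`. -/
theorem rkInv_rkMap (coef x : Fin n → ℚ) (c₀ : ℚ) (hJ : rkJac coef x ≠ 0) (w : Fin n → ℝ) :
    rkInv coef x c₀ (rkMap coef x c₀ w) = w := by
  have hJ' : (1 : ℝ) + ((∑ l, coef l * x l : ℚ) : ℝ) ≠ 0 := by
    rw [← cast_rkJac]; exact_mod_cast hJ
  have key : (rkFun coef (rkMap coef x c₀ w) + c₀) / (rkJac coef x : ℝ) = rkFun coef w + c₀ := by
    rw [rkMap, rkFun_add_smul, cast_rkJac]
    field_simp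
    ring
  rw [rkInv, key, rkMap, add_sub_cancel_right]

/-- `Ψ` is injective. -/
theorem rkMap_injective (coef x : Fin n → ℚ) (c₀ : ℚ) (hJ : rkJac coef x ≠ 0) :
    Function.Injective (rkMap coef x c₀) := fun w w' h => by
  rw [← rkInv_rkMap coef x c₀ hJ w, ← rkInv_rkMap coef x c₀ hJ w', h]

/-- `Ψ⁻¹` is continuous. -/
theorem continuous_rkInv (coef x : Fin n → ℚ) (c₀ : ℚ) : Continuous (rkInv coef x c₀) := by
  refine continuous_pi fun l => ?_
  simp only [rkInv_apply]
  fun_prop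

/-- The polynomials of `Ψ`. -/
def rkPoly (coef x : Fin n → ℚ) (c₀ : ℚ) (l : Fin n) : MvPolynomial (Fin n) ℚ :=
  X l + ((∑ l', MvPolynomial.C (coef l') * X l') + MvPolynomial.C c₀) * MvPolynomial.C (x l)

/-- `rkPoly` evaluates to `Ψ`. -/
theorem aeval_rkPoly (coef x : Fin n → ℚ) (c₀ : ℚ) (w : Fin n → ℝ) :
    (fun l => aeval w (rkPoly coef x c₀ l)) = rkMap coef x c₀ w := by
  funext l
  rw [rkMap_apply]
  simp [rkPoly, map_sum]

/-- `Ψ` is a `ℚ`-semialgebraic map on every `ℚ`-semialgebraic set. -/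
theorem isSemialgebraicMapOn_rkMap {S : Set (Fin n → ℝ)} (hS : IsSemialgebraic ℚ S)
    (coef x : Fin n → ℚ) (c₀ : ℚ) : IsSemialgebraicMapOn ℚ S (rkMap coef x c₀) :=
  (isSemialgebraicMapOn_aeval hS (rkPoly coef x c₀)).congr fun w _ => aeval_rkPoly coef x c₀ w

/-! ### The move -/

/-- **Rank-one rational affine change of variables** (rule 2, pull-back form). Let
`Ψ w = w + (φ(w) + c₀) · x` be non-degenerate (`1 + φ(x) ≠ 0`), let the `ℚ`-semialgebraic set `R`
be exchanged with the domain of `r` by `Ψ` and `Ψ⁻¹`, and let `f'` be a `ℚ`-semialgebraic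
function on `R` with `f' = (r.integrand ∘ Ψ) · |1 + φ(x)|` there. Then `R` carries a
representation `r'` with integrand `f'`, bounded if `r` is, and `[r] − [r'] ∈ KZ.relations`.
[Kontsevich–Zagier 2001, §1.2, rule (2)] -/
theorem rankOne_cov (r : KZ.IntegralRep n) (coef x : Fin n → ℚ) (c₀ : ℚ) (hJ : rkJac coef x ≠ 0)
    {R : Set (Fin n → ℝ)} (hR : IsSemialgebraic ℚ R) (hRD : ∀ w ∈ R, rkMap coef x c₀ w ∈ r.domain)
    (hDR : ∀ z ∈ r.domain, rkInv coef x c₀ z ∈ R) (f' : (Fin n → ℝ) → ℝ)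
    (hf'sa : IsSemialgebraicFunOn ℚ R f')
    (hf : ∀ w ∈ R, f' w = r.integrand (rkMap coef x c₀ w) * |(rkJac coef x : ℝ)|) :
    ∃ r' : KZ.IntegralRep n, r'.domain = R ∧ r'.integrand = f' ∧
      (Bornology.IsBounded r.domain → Bornology.IsBounded r'.domain) ∧
      KZ.of r - KZ.of r' ∈ KZ.relations := by
  have himg : rkMap coef x c₀ '' R = r.domain := by
    ext z
    constructor
    · rintro ⟨w, hw, rfl⟩
      exact hRD w hw
    · intro hz
      exact ⟨rkInv coef x c₀ z, hDR z hz, rkMap_rkInv coef x c₀ hJ z⟩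
  obtain ⟨r', hd', hi', hrel⟩ := cov_pull r hR (rkMap coef x c₀) (fun _ => rkLin coef x)
    (isSemialgebraicMapOn_rkMap hR coef x c₀)
    (fun w _ => (hasFDerivAt_rkMap coef x c₀ w).hasFDerivWithinAt)
    (rkMap_injective coef x c₀ hJ).injOn himg f' hf'sa
    (fun w hw => by rw [hf w hw, rkLin_det])
  refine ⟨r', hd', hi', fun hbd => ?_, hrel⟩
  rw [hd']
  refine (hbd.isCompact_closure.image (continuous_rkInv coef x c₀)).isBounded.subset fun w hw => ?_
  exact ⟨rkMap coef x c₀ w, subset_closure (hRD w hw), rkInv_rkMap coef x c₀ hJ w⟩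

end RebaseDiff

/-- **Registered brick `rebaseSimpleZero_rankOneCov` of the part `rebaseSimpleZero_nestedDifferent`
(stub `stub_rebaseSimpleZeroTwo`, line `janus-bands`): rank-one rational affine change of
variables** (rule 2, pull-back form). For `Ψ w = w + (φ(w) + c₀) · x` with a rational linear
functional `φ`, a rational vector `x`, a rational constant `c₀` and `1 + φ(x) ≠ 0`, a
`ℚ`-semialgebraic set `R` exchanged with the domain of `r` by `Ψ`/`Ψ⁻¹` carries a representation
with the integrand `(r.integrand ∘ Ψ) · |1 + φ(x)|` (any `ℚ`-semialgebraic function agreeing with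
it on `R`), bounded if `r` is, congruent to `r` modulo `KZ.relations` (`RebaseDiff.rankOne_cov`).
[Kontsevich–Zagier 2001, §1.2, rule (2)] -/
theorem rebaseSimpleZero_rankOneCov (n : ℕ) (r : KZ.IntegralRep n) (coef x : Fin n → ℚ) (c₀ : ℚ) (hJ : RebaseDiff.rkJac coef x ≠ 0) (R : Set (Fin n → ℝ)) (hR : IsSemialgebraic ℚ R) (hRD : ∀ w ∈ R, RebaseDiff.rkMap coef x c₀ w ∈ r.domain) (hDR : ∀ z ∈ r.domain, RebaseDiff.rkInv coef x c₀ z ∈ R) (f' : (Fin n → ℝ) → ℝ) (hf'sa : IsSemialgebraicFunOn ℚ R f') (hf : ∀ w ∈ R, f' w = r.integrand (RebaseDiff.rkMap coef x c₀ w) * |(RebaseDiff.rkJac coef x : ℝ)|) : ∃ r' : KZ.IntegralRep n, r'.domain = R ∧ r'.integrand = f' ∧ (Bornology.IsBounded r.domain → Bornology.IsBounded r'.domain) ∧ KZ.of r - KZ.of r' ∈ KZ.relations :=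
  RebaseDiff.rankOne_cov r coef x c₀ hJ hR hRD hDR f' hf'sa hf

end Summit.KontsevichZagierPeriods.ArrangementNormalForm.JanusBands
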